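import Summits.ABC.ABC.Theses.RibetTakahashiSplit
import Summits.ABC.ABC.Theorems.RibetTakahashiSplitThinWeightedSzpiroDefs
import Summits.ABC.ABC.Theorems.RibetTakahashiSplitThinWeightedSzpiroStubLocalData
import Summits.ABC.ABC.Theorems.RibetTakahashiSplitThinWeightedSzpiroStubWeights
import Summits.ABC.ABC.Theorems.RibetTakahashiSplitThinWeightedSzpiroStubTransfer
import Literature.NumberTheory.EllipticCurves.Szpiro

/-!
# Line `Sketch` (idea `thin-strong-hall-transfer`) for crux `RibetTakahashiSplit.ThinWeightedSzpiro`
(item stmt-ABC-17927, route route-ABC-RibetTakahashiSplit) — LEAD SKELETON (rev L4)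

The crux r3″ (thin-class weighted Szpiro with a frozen class exponent) is reduced BY NAME to one
elliptic-curve-free statement about the map `(x, y) ↦ x³ − y²` (B–G Conj. 12.5.3-type "thin strong Hall",
weighted by the exponent product), via `x = c₄(W₀)`, `y = c₆(W₀)`, `z = x³ − y² = 1728·Δ(W₀)`
(`WeierstrassCurve.c_relation`):

* §0 objects of the line: LANDED as `Theorems/RibetTakahashiSplitThinWeightedSzpiroDefs.lean` (p150281, imported above):
  `rad5`, `wt5`, `Prim23`, `HallIneq`, `ThinLaw`, `ThinStrongHall{,Cusp,Bulk}`, the PROVED glue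
  `thinStrongHall_of_cusp_of_bulk` = registered `stub_glue`, `ThinLaw.mono`, `freyCurve_cusp`.
* §1 registered stubs. LANDED (rev L2, imported above, same namespace): `stub_localData` (p147685),
  `stub_weights` (p147744), `stub_transfer` (p147670) — so `ThinStrongHall → ThinWeightedSzpiro` is kernel-checked.
  `stub_glue` LANDED in the Defs file (p150281). Still OPEN (sorries live ONLY there): `stub_cusp`, `stub_bulk` (research).
  - `stub_localData`  (S, LANDED p147685) — minimality/semistability of a global minimal model semistable away from 2, read on
    `(c₄, c₆, 1728Δ)`: `z ≠ 0`, `1728 ∣ z`, `Prim23` (from `¬(2⁸∣c₄ ∧ 2¹¹∣c₆)`, `¬(3⁵∣c₄ ∧ 3⁹∣c₆)`,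
    `SzpiroMinimalityProofs`), and `p ≥ 5, p ∣ c₄ ⇒ p ∤ z` (additive ⇒ `p² ∣ N`, `SzpiroOfAbcProofs`);
  - `stub_weights`    (M, LANDED p147744) — conductor bookkeeping: `rad5 z ∣ N`, `N ∣ 768·rad5 z` (`f₂ ≤ 8` PROVED
    `conductorExponent_le_eight_holds`, `f₃ ≤ 1`, `f_p ≤ 1` by semistability), `wt5 z ≤ T`;
  - `stub_transfer`   (M, LANDED p147670) — real-inequality assembly: the two stubs above + the ℕ normal form ⇒ crux;
  - `stub_cusp`, `stub_bulk` (RESEARCH, abc-strength on the thin class: the Hall corner `|z| ≤ |x|³` and the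
    balanced bulk `|x|³ < |z|`).
* §2 `ThinWeightedSzpiro_of` — the composition, closing the crux by name modulo the stubs.

The provable stubs are stated WITHOUT the §0 vocabulary (products written out) so that their files land
independently of the Defs review; `stub_transfer`'s third hypothesis is `ThinStrongHall` unfolded.
-/

-- `Summit.<Summit>.<Problem>` is the mandated summit-side namespace (CONVENTIONS §2); for the
-- single-conjunct summit `ABC` the two coincide, so the duplicate `ABC.ABC` is deliberate.
set_option linter.dupNamespace false

namespace Summit.ABC.ABC.Theorems.ThinWeightedSzpiro

open Summit.ABC.ABC.Theses.RibetTakahashiSplit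

/-! ## §1 Registered stubs -/

/- LANDED stubs (imported): `stub_localData` (RibetTakahashiSplitThinWeightedSzpiroStubLocalData.lean, p147685),
`stub_weights` (…StubWeights.lean, p147744), `stub_transfer` (…StubTransfer.lean, p147670). Their registered
signatures are unchanged (see Lines/Sketch.lean rev L1 in the crux dir history / the landed files). -/

/- LANDED glue stub (imported from the Defs file, p150281): `stub_glue : ThinStrongHallCusp → ThinStrongHallBulk →
ThinStrongHall` (= `thinStrongHall_of_cusp_of_bulk`). -/

/-- STUB (RESEARCH, abc-strength): the cusp half `|z| ≤ |x|³` of the ℕ normal form — weighted thin strong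
Hall in the Hall corner (kernel on squarefree `z`: weak Hall `|x| ≪ rad(z)^{2+ε}`, open). -/
theorem stub_cusp : ThinStrongHallCusp := by
  sorry

/-- STUB (RESEARCH, abc-strength): the bulk half `|x|³ < |z|` — weighted Szpiro for balanced `x³ − y² = z`
on the thin class. -/
theorem stub_bulk : ThinStrongHallBulk := by
  sorry

/-! ## §2 Composition -/

/-- The line closes the crux BY NAME modulo the registered stubs:
`stub_transfer stub_localData stub_weights (stub_glue stub_cusp stub_bulk)` — four of the five names are LANDED theorems;
only `stub_cusp`, `stub_bulk` are sorries. -/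
theorem ThinWeightedSzpiro_of : ThinWeightedSzpiro :=
  stub_transfer stub_localData stub_weights (stub_glue stub_cusp stub_bulk)

end Summit.ABC.ABC.Theorems.ThinWeightedSzpiro
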